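import Summits.AtomisticToContinuum.Crystallization.Theses.PhononSlackCertificates

/-!
# Crux `CoerciveTwoShellGap` (stmt-AtomisticToContinuum-13956), line `Sketch` — diagnostic on card B

Card B (`zero-stress-flux-gauge`) of the line files the C⁺ `PointwiseStarInequality` (ideator 1's
`Sketch.lean` = `Cruxes/CoerciveTwoShellGap/IdeatorOneSketch.lean`, not a built module, so its
definitions are COPIED verbatim below): a local transfer rule `T`, a sitewise REFERENCE VALUE
`eref : (N : ℕ) → (Fin N → ℝ³) → Fin N → ℝ`, (a) a pointwise star inequality at every particle and
(b) a global tail inequality; the card's summation lemma gives `PointwiseStarInequality →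
CoerciveTwoShellGap`.

THIS FILE (lead, kernel-checked): AS TYPED, `PointwiseStarInequality ↔ CoerciveTwoShellGap`
(`pointwiseStarInequality_iff`).  The converse takes the ZERO transfer rule and the reference value
`eref N x i := ½ · truncSiteEnergy R x i − g · [i is 1/20-bad]`, for which (a) holds with equality and
(b) IS the crux inequality (`Σᵢ ½(trunc + tail) = E_LJ(x)`).  So card B's C⁺ is a restatement of
the crux, not a reduction: `eref` is an unconstrained function of the whole configuration.  The
card's INTENDED content — `eref` = the `R`-truncated Barlow energy at the particle's fitted scale, a
LOCAL quantity, plus a kit-certified finite-range transfer rule — is not expressed by the typed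
`Prop`; a faithful C⁺ must constrain `eref` to be local (e.g. a field of `TransferRule`-like data with
an `isLocal` clause), and is then Flyspeck-scale certificate work (the route's `FarFieldGapR`
programme).  The lead therefore did not register card B's C⁺ as a stub.
-/

noncomputable section

namespace Summit.AtomisticToContinuum.Crystallization.Cruxes.CoerciveTwoShellGap.CardBDiagnostic

open scoped BigOperators Classical
open Literature.MathematicalPhysics.StatisticalMechanics Literature.Geometry.DiscreteGeometry
open Summit.AtomisticToContinuum.Crystallization.Theses.PhononSlackCertificates (CoerciveTwoShellGap)

/-- Euclidean `3`-space. -/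
local notation "E3" => EuclideanSpace ℝ (Fin 3)

/-! ## Card B's definitions (verbatim from `IdeatorOneSketch.lean`) -/

/-- `e* = ⨅_Q e(Q)`. -/
def ePer : ℝ := ⨅ Q : PeriodicConfiguration 3, Q.energyPerParticle lennardJones

/-- A LOCAL TRANSFER RULE of radius `R` and size `B` (card B). -/
structure TransferRule (R B : ℝ) where
  /-- the transfer -/
  τ : {N : ℕ} → (Fin N → E3) → Fin N → Fin N → ℝ
  antisymm : ∀ {N : ℕ} (x : Fin N → E3) (i j : Fin N), τ x j i = -τ x i j
  bounded : ∀ {N : ℕ} (x : Fin N → E3) (i j : Fin N), |τ x i j| ≤ B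
  finiteRange : ∀ {N : ℕ} (x : Fin N → E3) (i j : Fin N), R < dist (x i) (x j) → τ x i j = 0
  isLocal : ∀ {N : ℕ} (x y : Fin N → E3) (i j : Fin N),
    (∀ k : Fin N, (dist (x k) (x i) ≤ 2 * R ∨ dist (x k) (x j) ≤ 2 * R ∨
        dist (y k) (y i) ≤ 2 * R ∨ dist (y k) (y j) ≤ 2 * R) → y k = x k) →
      τ y i j = τ x i j

/-- The `R`-truncated site energy (card B). -/
def truncSiteEnergy (R : ℝ) {N : ℕ} (x : Fin N → E3) (i : Fin N) : ℝ :=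
  ∑ k ∈ (Finset.univ.erase i).filter (fun k => dist (x i) (x k) ≤ R), lennardJones (dist (x i) (x k))

/-- The tail of the site energy beyond `R` (card B). -/
def tailSiteEnergy (R : ℝ) {N : ℕ} (x : Fin N → E3) (i : Fin N) : ℝ :=
  ∑ k ∈ (Finset.univ.erase i).filter (fun k => ¬ dist (x i) (x k) ≤ R), lennardJones (dist (x i) (x k))

/-- `siteEnergy = truncSiteEnergy R + tailSiteEnergy R` (card B). -/
theorem siteEnergy_eq_trunc_add_tail (R : ℝ) {N : ℕ} (x : Fin N → E3) (i : Fin N) :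
    siteEnergy lennardJones x i = truncSiteEnergy R x i + tailSiteEnergy R x i := by
  unfold siteEnergy truncSiteEnergy tailSiteEnergy
  rw [Finset.sum_filter_add_sum_filter_not]

/-- **C⁺ of card B**, verbatim. -/
def PointwiseStarInequality : Prop :=
  ∀ δ : ℝ, 0 < δ → ∃ g : ℝ, 0 < g ∧ ∃ R B : ℝ, ∃ T : TransferRule R B,
    ∃ eref : (N : ℕ) → (Fin N → E3) → Fin N → ℝ,
      (∀ (N : ℕ) (x : Fin N → E3), (∀ i j : Fin N, i ≠ j → δ ≤ dist (x i) (x j)) →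
        ∀ i : Fin N, eref N x i + (if IsTwoShellGood (1 / 20) (47 / 50) 1 x i then 0 else g)
          ≤ (1 / 2) * truncSiteEnergy R x i + ∑ j : Fin N, T.τ x i j) ∧
      (∀ (N : ℕ) (x : Fin N → E3), (∀ i j : Fin N, i ≠ j → δ ≤ dist (x i) (x j)) →
        (N : ℝ) * ePer ≤ ∑ i : Fin N, (eref N x i + (1 / 2) * tailSiteEnergy R x i))

/-! ## The zero transfer rule and the bookkeeping identities -/

/-- The zero transfer rule (any radius, any non-negative size). -/
def zeroRule (R : ℝ) : TransferRule R 0 where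
  τ := fun _ _ _ => 0
  antisymm := fun _ _ _ => by simp
  bounded := fun _ _ _ => by simp
  finiteRange := fun _ _ _ _ => rfl
  isLocal := fun _ _ _ _ _ => rfl

/-- `Σᵢ ½ (trunc + tail) = E_LJ(x)`. -/
theorem sum_half_trunc_add_tail (R : ℝ) {N : ℕ} (x : Fin N → E3) :
    ∑ i : Fin N, ((1 / 2 : ℝ) * truncSiteEnergy R x i + (1 / 2) * tailSiteEnergy R x i) =
      interactionEnergy lennardJones x := by
  have h : ∀ i : Fin N, (1 / 2 : ℝ) * truncSiteEnergy R x i + 1 / 2 * tailSiteEnergy R x i =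
      (1 / 2 : ℝ) * siteEnergy lennardJones x i := fun i => by
    rw [siteEnergy_eq_trunc_add_tail R x i]; ring
  rw [Finset.sum_congr rfl fun i _ => h i, ← Finset.mul_sum, ← two_mul_interactionEnergy]
  ring

/-- The bad count as a sum of indicators. -/
theorem card_bad_eq_sum {N : ℕ} (x : Fin N → E3) :
    (Nat.card {i : Fin N // ¬ IsTwoShellGood (1 / 20) (47 / 50) 1 x i} : ℝ) =
      ∑ i : Fin N, (if IsTwoShellGood (1 / 20) (47 / 50) 1 x i then (0 : ℝ) else 1) := by
  rw [Nat.card_eq_fintype_card, Fintype.card_subtype, Finset.natCast_card_filter]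
  refine Finset.sum_congr rfl fun i _ => ?_
  split_ifs <;> simp

/-! ## The equivalence -/

/-- **Card B's summation lemma** (re-proved for the copied definitions): `PointwiseStarInequality →
CoerciveTwoShellGap`. -/
theorem coerciveTwoShellGap_of_pointwiseStarInequality (h : PointwiseStarInequality) :
    CoerciveTwoShellGap := by
  intro δ hδ
  obtain ⟨g, hg, R, B, T, eref, hpt, htail⟩ := h δ hδ
  refine ⟨g, hg, fun N x hx => ?_⟩
  have hp := hpt N x hx
  have ht := htail N x hx
  have hτ : ∑ i : Fin N, ∑ j : Fin N, T.τ x i j = 0 := by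
    have h1 : ∑ i : Fin N, ∑ j : Fin N, T.τ x i j = ∑ i : Fin N, ∑ j : Fin N, T.τ x j i :=
      Finset.sum_comm
    have h2 : ∑ i : Fin N, ∑ j : Fin N, T.τ x j i = -∑ i : Fin N, ∑ j : Fin N, T.τ x i j := by
      rw [← Finset.sum_neg_distrib]
      refine Finset.sum_congr rfl fun i _ => ?_
      rw [← Finset.sum_neg_distrib]
      exact Finset.sum_congr rfl fun j _ => T.antisymm x i j
    linarith
  have hsum : ∑ i : Fin N, (eref N x i + (if IsTwoShellGood (1 / 20) (47 / 50) 1 x i then 0 else g))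
      ≤ ∑ i : Fin N, ((1 / 2 : ℝ) * truncSiteEnergy R x i + ∑ j : Fin N, T.τ x i j) :=
    Finset.sum_le_sum fun i _ => hp i
  rw [Finset.sum_add_distrib, Finset.sum_add_distrib, hτ, add_zero] at hsum
  have hind : ∑ i : Fin N, (if IsTwoShellGood (1 / 20) (47 / 50) 1 x i then (0 : ℝ) else g) =
      g * (Nat.card {i : Fin N // ¬ IsTwoShellGood (1 / 20) (47 / 50) 1 x i} : ℝ) := by
    rw [card_bad_eq_sum, Finset.mul_sum]
    refine Finset.sum_congr rfl fun i _ => ?_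
    split_ifs <;> simp
  rw [hind] at hsum
  have hE := sum_half_trunc_add_tail R x
  rw [Finset.sum_add_distrib] at hE ht
  have : (N : ℝ) * ePer + g * (Nat.card {i : Fin N // ¬ IsTwoShellGood (1 / 20) (47 / 50) 1 x i} : ℝ)
      ≤ interactionEnergy lennardJones x := by linarith
  simpa only [ePer] using this

/-- **The converse: the crux gives card B's C⁺ with the ZERO transfer rule** and
`eref N x i := ½·truncSiteEnergy R x i − g·[i bad]` (any `R`; (a) holds with equality, (b) is the
crux). -/
theorem pointwiseStarInequality_of_coerciveTwoShellGap (h : CoerciveTwoShellGap) :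
    PointwiseStarInequality := by
  intro δ hδ
  obtain ⟨g, hg, hmain⟩ := h δ hδ
  refine ⟨g, hg, 1, 0, zeroRule 1, fun N x i =>
    (1 / 2 : ℝ) * truncSiteEnergy 1 x i - (if IsTwoShellGood (1 / 20) (47 / 50) 1 x i then 0 else g),
    fun N x _ i => ?_, fun N x hx => ?_⟩
  · simp only [zeroRule, Finset.sum_const_zero, add_zero]
    linarith
  · have key := hmain N x hx
    have hE := sum_half_trunc_add_tail 1 x
    have hind : ∑ i : Fin N, (if IsTwoShellGood (1 / 20) (47 / 50) 1 x i then (0 : ℝ) else g) =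
        g * (Nat.card {i : Fin N // ¬ IsTwoShellGood (1 / 20) (47 / 50) 1 x i} : ℝ) := by
      rw [card_bad_eq_sum, Finset.mul_sum]
      refine Finset.sum_congr rfl fun i _ => ?_
      split_ifs <;> simp
    have hsplit : ∑ i : Fin N, ((1 / 2 : ℝ) * truncSiteEnergy 1 x i -
        (if IsTwoShellGood (1 / 20) (47 / 50) 1 x i then 0 else g) + (1 / 2) * tailSiteEnergy 1 x i) =
        interactionEnergy lennardJones x -
          g * (Nat.card {i : Fin N // ¬ IsTwoShellGood (1 / 20) (47 / 50) 1 x i} : ℝ) := by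
      rw [← hE, ← hind, ← Finset.sum_sub_distrib]
      refine Finset.sum_congr rfl fun i _ => ?_
      ring
    rw [hsplit]
    have : (N : ℝ) * ePer = (N : ℝ) * (⨅ Q : PeriodicConfiguration 3, Q.energyPerParticle lennardJones) := rfl
    linarith

/-- **AS TYPED, card B's C⁺ is the crux.** -/
theorem pointwiseStarInequality_iff : PointwiseStarInequality ↔ CoerciveTwoShellGap :=
  ⟨coerciveTwoShellGap_of_pointwiseStarInequality, pointwiseStarInequality_of_coerciveTwoShellGap⟩

end Summit.AtomisticToContinuum.Crystallization.Cruxes.CoerciveTwoShellGap.CardBDiagnostic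

end
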